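import Summits.ValiantsHypothesis.ValiantsHypothesis.Theses.LacunarySymmetroid
import Summits.ValiantsHypothesis.ValiantsHypothesis.Theorems.LacunarySymmetroidMatrixDescartesStubPsdDominate
import Summits.ValiantsHypothesis.ValiantsHypothesis.Theorems.LacunarySymmetroidMatrixDescartesStubPsdBlocks
import Summits.ValiantsHypothesis.ValiantsHypothesis.Theorems.LacunarySymmetroidMatrixDescartesStubLiftDet
import Summits.ValiantsHypothesis.ValiantsHypothesis.Theorems.LacunarySymmetroidMatrixDescartesStubArith
import Summits.ValiantsHypothesis.ValiantsHypothesis.Theorems.LacunarySymmetroidMatrixDescartesStubNegRoots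
import Summits.ValiantsHypothesis.ValiantsHypothesis.Theorems.LacunarySymmetroidMatrixDescartesStubArith3
import Summits.ValiantsHypothesis.ValiantsHypothesis.Theorems.LacunarySymmetroidMatrixDescartesStubArith4
import Summits.ValiantsHypothesis.ValiantsHypothesis.Theorems.LacunarySymmetroidMatrixDescartesFirstRung
import Summits.ValiantsHypothesis.ValiantsHypothesis.Theorems.MatrixDescartes.Negative.MatrixDescartesOneIndefiniteIff

/-!
# Crux `MatrixDescartes` (stmt-ValiantsHypothesis-18050), line `Lift` — the normal form as tree theorems

The line's skeleton (`Cruxes/MatrixDescartes/Lines/Lift.lean`, leads 0–c3) proves the crux BY NAME from its stubs; all stubs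
but the crux-equivalent `stub_twoSided` are tree theorems.  This file extracts the skeleton's sorry-free GLUE so that the
normal form is importable:

* `matrixDescartes_of_oneIndefinitePos` — C⁺₊ (the matrix Descartes rule in positive-root currency for
  `X^e J + ∑ₖ X^{dₖ} Pₖ`, `Pₖ ⪰ 0`, one symmetric pivot `J`) ⇒ `MatrixDescartes` (PSD lift of `F(X)` and `F(−X)`, block-unipotent
  factorisation, regime bookkeeping `(c,q,K) ↦ (c+2, 4q, 2K)`);
* `oneIndefinitePos_of_twoSided` — the ONE-SIDED sector is the first rung (`firstRung_oneSided`, p152277, `Z₊ ≤ card ι`,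
  absorbed by the regime via `stub_arith4`), so C⁺₊ reduces to its TWO-SIDED remainder (PSD exponents on both sides of
  the pivot) — the statement of the registered stub `stub_twoSided`;
* `matrixDescartes_of_twoSided` — hence TwoSided ⇒ crux;
* `matrixDescartes_of_oneIndefiniteDescartes`, `matrixDescartes_iff_oneIndefiniteDescartes` — with the landed converse
  `oneIndefiniteDescartes_of_matrixDescartes` (p150097) the tree now holds the full equivalence
  `MatrixDescartes ↔ OneIndefiniteDescartes` (total-root currency C⁺ of the Disproof file): the line is a normal form with
  zero slack, kernel-checked in both directions.

No new definitions (the two-sided statement is written out as a hypothesis). [folklore] glue; the mathematics is in the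
imported stub files.
-/

-- layout Summits/ValiantsHypothesis/ValiantsHypothesis forces the duplicated namespace component
set_option linter.dupNamespace false

namespace Summit.ValiantsHypothesis.ValiantsHypothesis.Theorems.LacunarySymmetroidMatrixDescartes

open Summit.ValiantsHypothesis.ValiantsHypothesis.Theses.LacunarySymmetroid
open Summit.ValiantsHypothesis.ValiantsHypothesis.Theorems.MatrixDescartes.Negative (OneIndefiniteDescartes
  oneIndefiniteDescartes_of_matrixDescartes)
open Polynomial Matrix Finset
open scoped BigOperators

namespace LiftNormalForm

/-- Positive-root bookkeeping: if `g = C a * X ^ M * f` with `a ≠ 0` then `f` and `g` have the same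
distinct positive roots. -/
theorem posRoots_eq_of_eq_C_mul_X_pow_mul (f g : Polynomial ℝ) (a : ℝ) (M : ℕ) (ha : a ≠ 0)
    (h : g = Polynomial.C a * (Polynomial.X : Polynomial ℝ) ^ M * f) :
    (g.roots.toFinset.filter (fun t => 0 < t)) = (f.roots.toFinset.filter (fun t => 0 < t)) := by
  by_cases hf : f = 0
  · simp [h, hf]
  · have hCX : Polynomial.C a * (Polynomial.X : Polynomial ℝ) ^ M ≠ 0 :=
      mul_ne_zero (Polynomial.C_ne_zero.mpr ha) (pow_ne_zero _ Polynomial.X_ne_zero)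
    have hprod : Polynomial.C a * (Polynomial.X : Polynomial ℝ) ^ M * f ≠ 0 := mul_ne_zero hCX hf
    rw [h, Polynomial.roots_mul hprod, Polynomial.roots_C_mul_X_pow ha, Multiset.toFinset_add,
      Finset.filter_union]
    have h0 : ((M • ({0} : Multiset ℝ)).toFinset.filter (fun t => (0 : ℝ) < t)) = ∅ := by
      ext t
      simp only [Finset.mem_filter, Multiset.mem_toFinset, Multiset.mem_nsmul, Multiset.mem_singleton,
        Finset.notMem_empty, iff_false, not_and, not_lt]
      rintro ⟨-, rfl⟩
      exact le_rfl
    rw [h0, Finset.empty_union]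

end LiftNormalForm

open LiftNormalForm

/-- **The transfer (PSD lift, two lifts `F(X)` and `F(−X)`)**: the matrix Descartes rule in positive-root
currency for pencils `X^e J + ∑ₖ X^{dₖ} Pₖ` (`J` symmetric, `Pₖ ⪰ 0`, arbitrary finite index types; hypothesis
`h`, the line's C⁺₊) implies the crux `MatrixDescartes`.  Every v1–v3 stub it uses is a tree theorem
(p147006, p147024, p147140, p148960, p151025, p150758). -/
theorem matrixDescartes_of_oneIndefinitePos
    (h : ∀ c q : ℕ, 0 < q → ∃ K₀ : ℕ, ∀ (ι κ : Type) [Fintype ι] [DecidableEq ι] [Fintype κ],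
          K₀ ≤ Fintype.card κ → Fintype.card ι ≤ 2 ^ ((Nat.log 2 (Fintype.card κ) + c) ^ c) →
          ∀ (e : ℕ) (d : κ → ℕ) (J : Matrix ι ι ℝ) (P : κ → Matrix ι ι ℝ),
            J.IsSymm → (∀ k, (P k).PosSemidef) →
            ((Matrix.det (((Polynomial.X : Polynomial ℝ) ^ e) • J.map Polynomial.C
                + ∑ k, ((Polynomial.X : Polynomial ℝ) ^ d k) • (P k).map Polynomial.C)).roots.toFinset.filter
                  (fun t => 0 < t)).card ^ q
              ≤ 2 ^ (Fintype.card κ * Nat.log 2 (Fintype.card κ))) :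
    MatrixDescartes := by
  intro c q hq
  obtain ⟨K₀', hK'⟩ := h (c + 2) (4 * q) (by omega)
  refine ⟨max K₀' (max 4 (4 * q)), ?_⟩
  intro K m hK hm d S hS
  have hK4 : 4 ≤ K := le_trans (le_max_left _ _) (le_trans (le_max_right _ _) hK)
  have hKq : 4 * q ≤ K := le_trans (le_max_right _ _) (le_trans (le_max_right _ _) hK)
  have hK₀' : K₀' ≤ K := le_trans (le_max_left _ _) hK
  -- size / term bookkeeping (shared by both lifts)
  let ι : Type := (Fin m × Fin K) ⊕ Fin m
  let κ : Type := Fin K ⊕ Fin K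
  have hcardκ : Fintype.card κ = K + K := by
    simp [κ, Fintype.card_sum, Fintype.card_fin]
  have hcardι : Fintype.card ι = m * K + m := by
    simp [ι, Fintype.card_sum, Fintype.card_prod, Fintype.card_fin]
  have hlogK : Nat.log 2 (K + K) = Nat.log 2 K + 1 := by
    rw [← two_mul, mul_comm]
    exact Nat.log_mul_base (by norm_num) (by omega)
  have hK₀κ : K₀' ≤ Fintype.card κ := by rw [hcardκ]; omega
  have hsize : Fintype.card ι ≤ 2 ^ ((Nat.log 2 (Fintype.card κ) + (c + 2)) ^ (c + 2)) := by
    rw [hcardι, hcardκ, hlogK]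
    have hK1 : K + 1 ≤ 2 ^ (Nat.log 2 K + 1) := Nat.lt_pow_succ_log_self (by norm_num) K
    calc m * K + m = m * (K + 1) := by ring
      _ ≤ 2 ^ ((Nat.log 2 K + c) ^ c) * 2 ^ (Nat.log 2 K + 1) := Nat.mul_le_mul hm hK1
      _ = 2 ^ (Nat.log 2 K + 1 + (Nat.log 2 K + c) ^ c) := by rw [← pow_add]; ring_nf
      _ ≤ 2 ^ ((Nat.log 2 K + 1 + (c + 2)) ^ (c + 2)) :=
          Nat.pow_le_pow_right (by norm_num)
            (Summit.ValiantsHypothesis.ValiantsHypothesis.Theorems.LacunarySymmetroidMatrixDescartes.stub_arith.1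
              c (Nat.log 2 K))
  set e : ℕ := ∑ l, d l with hedef
  have he : ∀ l, d l ≤ e := fun l =>
    Finset.single_le_sum (f := d) (fun i _ => Nat.zero_le _) (Finset.mem_univ l)
  let W : Matrix (Fin m) (Fin m × Fin K) ℝ :=
    Matrix.of fun (i : Fin m) (jl : Fin m × Fin K) => if i = jl.1 then (1 : ℝ) else 0
  let J : Matrix ι ι ℝ :=
    Matrix.fromBlocks (0 : Matrix (Fin m × Fin K) (Fin m × Fin K) ℝ) Wᵀ W (0 : Matrix (Fin m) (Fin m) ℝ)
  have hJ : J.IsSymm := by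
    show (Matrix.fromBlocks 0 Wᵀ W 0)ᵀ = Matrix.fromBlocks 0 Wᵀ W 0
    rw [Matrix.fromBlocks_transpose, Matrix.transpose_zero, Matrix.transpose_zero,
      Matrix.transpose_transpose]
  let d' : κ → ℕ := Sum.elim (fun l => e - d l) (fun l => e + d l)
  -- the lift of a symmetric family `T` (used for `T = S` and `T = (−1)^d • S`)
  have hlift : ∀ T : Fin K → Matrix (Fin m) (Fin m) ℝ, (∀ l, (T l).IsSymm) →
      ((Matrix.det (∑ l, ((Polynomial.X : Polynomial ℝ) ^ d l) • (T l).map Polynomial.C)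
        ).roots.toFinset.filter (fun t => 0 < t)).card ^ (4 * q) ≤ 2 ^ ((K + K) * Nat.log 2 (K + K)) := by
    intro T hT
    set γ : Fin K → ℝ := fun l => 1 + ∑ i, ∑ j, T l i j ^ 2 with hγdef
    have hγpos : ∀ l, 0 < γ l := fun l => by
      simp only [hγdef]
      positivity
    have hγ : ∀ l, γ l ≠ 0 := fun l => ne_of_gt (hγpos l)
    let P : κ → Matrix ι ι ℝ := Sum.elim
      (fun l => Matrix.fromBlocks
        (Matrix.diagonal fun jl : Fin m × Fin K => if jl.2 = l then (γ l)⁻¹ else 0)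
        0 0 (0 : Matrix (Fin m) (Fin m) ℝ))
      (fun l => Matrix.fromBlocks (0 : Matrix (Fin m × Fin K) (Fin m × Fin K) ℝ) 0 0
        (γ l • (1 : Matrix (Fin m) (Fin m) ℝ) - T l))
    have hP : ∀ k, (P k).PosSemidef := by
      obtain ⟨h1, h2⟩ :=
        Summit.ValiantsHypothesis.ValiantsHypothesis.Theorems.LacunarySymmetroidMatrixDescartes.stub_psdBlocks K m
      intro k
      cases k with
      | inl l =>
          simp only [P, Sum.elim_inl]
          exact h1 l _ (le_of_lt (inv_pos.mpr (hγpos l)))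
      | inr l =>
          simp only [P, Sum.elim_inr]
          exact h2 _ (by
            simpa [hγdef] using
              Summit.ValiantsHypothesis.ValiantsHypothesis.Theorems.LacunarySymmetroidMatrixDescartes.stub_psdDominate
                m (T l) (hT l))
    have hC := hK' ι κ hK₀κ hsize e d' J P hJ hP
    rw [hcardκ] at hC
    have hsum : ∑ k, ((Polynomial.X : Polynomial ℝ) ^ d' k) • (P k).map Polynomial.C
        = ∑ l : Fin K, ((Polynomial.X : Polynomial ℝ) ^ (e - d l)) •
              (Matrix.fromBlocks
                (Matrix.diagonal fun jl : Fin m × Fin K => if jl.2 = l then (γ l)⁻¹ else 0)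
                0 0 (0 : Matrix (Fin m) (Fin m) ℝ)).map Polynomial.C
          + ∑ l : Fin K, ((Polynomial.X : Polynomial ℝ) ^ (e + d l)) •
              (Matrix.fromBlocks (0 : Matrix (Fin m × Fin K) (Fin m × Fin K) ℝ) 0 0
                (γ l • (1 : Matrix (Fin m) (Fin m) ℝ) - T l)).map Polynomial.C := by
      simp only [κ, Fintype.sum_sum_type, d', P, Sum.elim_inl, Sum.elim_inr]
    rw [hsum, ← add_assoc] at hC
    obtain ⟨a, M, ha, hdet⟩ :=
      Summit.ValiantsHypothesis.ValiantsHypothesis.Theorems.LacunarySymmetroidMatrixDescartes.stub_liftDet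
        K m γ hγ d e he T
    rwa [posRoots_eq_of_eq_C_mul_X_pow_mul _ _ a M ha hdet] at hC
  -- the two lifts and the bookkeeping
  have hSneg : ∀ l, (((-1 : ℝ) ^ d l) • S l).IsSymm := fun l => (hS l).smul _
  have hA := hlift S hS
  have hB := hlift (fun l => ((-1 : ℝ) ^ d l) • S l) hSneg
  exact stub_arith3 K q _ _ _ hK4 hKq (stub_negRoots K m d S) hA hB


/-- **C⁺₊ from its two-sided remainder**: the one-sided sector (`e ≤ min d` or `e ≥ max d`) is the first rung
`firstRung_oneSided` (`Z₊ ≤ card ι`, absorbed by the regime, `stub_arith4`); the two-sided remainder is the hypothesis. -/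
theorem oneIndefinitePos_of_twoSided
    (h2 : ∀ c q : ℕ, 0 < q → ∃ K₀ : ℕ, ∀ (ι κ : Type) [Fintype ι] [DecidableEq ι] [Fintype κ],
          K₀ ≤ Fintype.card κ → Fintype.card ι ≤ 2 ^ ((Nat.log 2 (Fintype.card κ) + c) ^ c) →
          ∀ (e : ℕ) (d : κ → ℕ) (J : Matrix ι ι ℝ) (P : κ → Matrix ι ι ℝ),
            J.IsSymm → (∀ k, (P k).PosSemidef) → (∃ k, d k < e) → (∃ k, e < d k) →
            ((Matrix.det (((Polynomial.X : Polynomial ℝ) ^ e) • J.map Polynomial.C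
                + ∑ k, ((Polynomial.X : Polynomial ℝ) ^ d k) • (P k).map Polynomial.C)).roots.toFinset.filter
                  (fun t => 0 < t)).card ^ q
              ≤ 2 ^ (Fintype.card κ * Nat.log 2 (Fintype.card κ))) :
    ∀ c q : ℕ, 0 < q → ∃ K₀ : ℕ, ∀ (ι κ : Type) [Fintype ι] [DecidableEq ι] [Fintype κ],
    K₀ ≤ Fintype.card κ → Fintype.card ι ≤ 2 ^ ((Nat.log 2 (Fintype.card κ) + c) ^ c) →
    ∀ (e : ℕ) (d : κ → ℕ) (J : Matrix ι ι ℝ) (P : κ → Matrix ι ι ℝ),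
      J.IsSymm → (∀ k, (P k).PosSemidef) →
      ((Matrix.det (((Polynomial.X : Polynomial ℝ) ^ e) • J.map Polynomial.C
          + ∑ k, ((Polynomial.X : Polynomial ℝ) ^ d k) • (P k).map Polynomial.C)).roots.toFinset.filter
            (fun t => 0 < t)).card ^ q
        ≤ 2 ^ (Fintype.card κ * Nat.log 2 (Fintype.card κ)) := by
  intro c q hq
  obtain ⟨K₂, hK₂⟩ := h2 c q hq
  obtain ⟨K₁, hK₁⟩ := stub_arith4 c q
  refine ⟨max K₁ K₂, ?_⟩
  intro ι κ _ _ _ hK hsize e d J P hJ hP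
  by_cases htwo : (∃ k, d k < e) ∧ (∃ k, e < d k)
  · exact hK₂ ι κ (le_trans (le_max_right _ _) hK) hsize e d J P hJ hP htwo.1 htwo.2
  · have hone : (∀ k, e ≤ d k) ∨ (∀ k, d k ≤ e) := by
      by_contra hcon
      push Not at hcon
      obtain ⟨⟨k₁, hk₁⟩, ⟨k₂, hk₂⟩⟩ := hcon
      exact htwo ⟨⟨k₁, hk₁⟩, ⟨k₂, hk₂⟩⟩
    exact le_trans (Nat.pow_le_pow_left (firstRung_oneSided ι κ e d J P hJ hP hone) q)
      (hK₁ (Fintype.card κ) (Fintype.card ι) (le_trans (le_max_left _ _) hK) hsize)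

/-- **TwoSided ⇒ crux**: the two-sided matrix Descartes rule (registered stub `stub_twoSided` of line `Lift`, written
out as the hypothesis) implies `MatrixDescartes`. -/
theorem matrixDescartes_of_twoSided
    (h2 : ∀ c q : ℕ, 0 < q → ∃ K₀ : ℕ, ∀ (ι κ : Type) [Fintype ι] [DecidableEq ι] [Fintype κ],
          K₀ ≤ Fintype.card κ → Fintype.card ι ≤ 2 ^ ((Nat.log 2 (Fintype.card κ) + c) ^ c) →
          ∀ (e : ℕ) (d : κ → ℕ) (J : Matrix ι ι ℝ) (P : κ → Matrix ι ι ℝ),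
            J.IsSymm → (∀ k, (P k).PosSemidef) → (∃ k, d k < e) → (∃ k, e < d k) →
            ((Matrix.det (((Polynomial.X : Polynomial ℝ) ^ e) • J.map Polynomial.C
                + ∑ k, ((Polynomial.X : Polynomial ℝ) ^ d k) • (P k).map Polynomial.C)).roots.toFinset.filter
                  (fun t => 0 < t)).card ^ q
              ≤ 2 ^ (Fintype.card κ * Nat.log 2 (Fintype.card κ))) :
    MatrixDescartes :=
  matrixDescartes_of_oneIndefinitePos (oneIndefinitePos_of_twoSided h2)

/-- **C⁺ ⇒ crux** (total-root currency, the Disproof file's `OneIndefiniteDescartes`): a bound on ALL distinct real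
zeros bounds the positive ones. -/
theorem matrixDescartes_of_oneIndefiniteDescartes (h : OneIndefiniteDescartes) : MatrixDescartes := by
  refine matrixDescartes_of_oneIndefinitePos ?_
  intro c q hq
  obtain ⟨K₀, hK₀⟩ := h c q hq
  refine ⟨K₀, ?_⟩
  intro ι κ _ _ _ hK hsize e d J P hJ hP
  exact le_trans (Nat.pow_le_pow_left (Finset.card_filter_le _ _) q) (hK₀ ι κ hK hsize e d J P hJ hP)

/-- **The line is a zero-slack normal form**: `MatrixDescartes ↔ OneIndefiniteDescartes` (this file and p150097). -/
theorem matrixDescartes_iff_oneIndefiniteDescartes :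
    Summit.ValiantsHypothesis.ValiantsHypothesis.Theses.LacunarySymmetroid.MatrixDescartes ↔
      Summit.ValiantsHypothesis.ValiantsHypothesis.Theorems.MatrixDescartes.Negative.OneIndefiniteDescartes :=
  ⟨oneIndefiniteDescartes_of_matrixDescartes, matrixDescartes_of_oneIndefiniteDescartes⟩

end Summit.ValiantsHypothesis.ValiantsHypothesis.Theorems.LacunarySymmetroidMatrixDescartes
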